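import Literature.NumberTheory.GaloisCohomology.ShaOneMuRat
import Literature.NumberTheory.GaloisRepresentations.BlochKatoSelmerGroup
import HarnessLib

/-!
# Crux `PrintCf2.SplitBadTwoRankOneOfFacts` (stmt-BirchSwinnertonDyer-20368), S3n′-FACT-FREE road, brick R1′ (second half, θ = 1):
# THE KUMMER DICTIONARY AT `w ∤ p` — an UNRAMIFIED Kummer class has valuation divisible by `n`

Cell `bsd-print-cf2`, WIDTH seat `bsd-line-cf2-p1-w7` g6 (prover-bsd-line-cf2-p1-w7-g6-0); `--supports
stmt-BirchSwinnertonDyer-20368` (helper, Theses-free). HONEST FRAMING: nothing here closes the crux or a registered stub;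
BSD is not proved by any of this; no summit statement is proved by this seat. No definition, no named fact, no `sorry`.
UNCONDITIONAL.

WHAT (memo `Cruxes/SplitBadTwoRankOneOfFacts/S3N-FACTFREE-w2g14.md` §3/§7, piece (K-ur) of the Kummer dictionary asked for
by `-w2` g14, 2026-08-29T05:07:37Z; consumer: `KummerProNull.exists_level_kummerMap_eq_one_of_localization_eq_zero`,
p697446, whose hypothesis at `w ∤ v` is kept in valuation form `p^M ∣ log v_w(a)`). For a number field `F`, `n ≥ 1`,
`a ∈ F^×` and ANY finite place `w` of `F` (no hypothesis `w ∤ n`, no hypothesis `μ_n ⊆ F`):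

  **`loc_w δ_n(a) ∈ H¹_ur(F_w, μ_n)` ⟹ `(n : ℤ) ∣ log (w.valuation F a)`**
  (`dvd_log_valuation_of_localization_kummerMap_mem_unramifiedSubgroup`),

where `δ_n = kummerMap F n`, `loc_w = galoisCohomology.localization (mu F n) (Sum.inr w) 1` and `H¹_ur(F_w, μ_n) =
DiscreteGaloisModule.unramifiedSubgroup (GaloisRep.toLocal w (mu F n)) 1 = ker (H¹(F_w, μ_n) → H¹(F_w^{nr}, μ_n))`,
`F_w^{nr} = IsNonarchimedeanLocalField.maxUnramified F_w = F_w(μ_{p'})` (tree, `UnramifiedKummer`).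

Route (the one `-w2` g14 proposed): (1) `unramifiedSubgroup` is the kernel of the restriction to `F_w^{nr}`; composed
with the localisation this is the pull-back along the COMPOSITE `Γ_{F_w^{nr}} → Γ_{F_w} → Γ_F` (`galoisCohomology.res_comp`,
`localization_mem_unramifiedSubgroup_iff_pullback_comp_eq_zero`) — the composite differs from the direct restriction
`absGaloisRestrict F F_w^{nr}` by an inner automorphism of `Γ_F`, which is why the Kummer lemma is proved here for an
ARBITRARY compatible pair `(φ : Γ_E → Γ_K, ι : K̄ → Ē)` (`exists_eq_pow_of_pullback_kummerMap_eq_zero_of_compatible`,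
the tree's `ShaOneMuRat.exists_eq_pow_of_pullback_kummerMap_eq_zero` being the case `φ = absGaloisRestrict`); (2) so
`a = cⁿ` with `c ∈ F_w^{nr}` (`exists_eq_pow_of_pullback_comp_kummerMap_eq_zero`); (3) `F_w^{nr}/F_w` is UNRAMIFIED in
value-group form: `‖c‖ ∈ ‖ϖ‖^ℤ` (`IsNonarchimedeanLocalField.exists_algNorm_eq_zpow_of_mem_maxUnramified`), hence
`v(a) = v(ϖ)^{n m}` (`exists_valuation_eq_zpow_of_pow_eq_algebraMap_of_mem_maxUnramified`, abstract local field;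
`dvd_log_valued_of_pow_eq_algebraMap_of_mem_maxUnramified` for the completion `F_w`, Mathlib's `Valued.v : F_w → ℤᵐ⁰`);
(4) `Valued.v (a : F_w) = w.valuation F a` (Mathlib `valuedAdicCompletion_eq_valuation'`).
beyond-print theorem: no (Silverman AEC VIII.1.6 / Serre *Local Fields* IV §4 folklore). presearch: NOTES.md.

References: J.-P. Serre, *Local Fields* (1979), Ch. IV §4 Prop. 16, Cor. 2 (`K_nr = K(μ_{p'})` unramified), Ch. X §3
(Kummer); J. H. Silverman, *AEC* (2009), Prop. VIII.1.6 (proof: `K_v(a^{1/m})/K_v` unramified iff `m ∣ ord_v a`);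
J.-P. Serre, *Galois Cohomology* (1997), I §2.4 (compatible pairs).
-/

noncomputable section

set_option linter.dupNamespace false
set_option autoImplicit false

open scoped Classical WithZero
open NumberField IsDedekindDomain Field ValuativeRel
open Literature.NumberTheory.GaloisRepresentations
open Literature.NumberTheory.GaloisRepresentations.DiscreteGaloisModule
open Literature.NumberTheory.GaloisCohomology

namespace Summit.BirchSwinnertonDyer.BirchSwinnertonDyer.Theorems.PrintCf2.KummerProNull

/-! ### §1 Kummer classes pulled back along a compatible pair -/

section KummerCompatible

variable (K E : Type) [Field K] [Field E] [Algebra K E] [CharZero E] (n : ℕ) [NeZero (n : K)]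

/-- **A Kummer class that dies along a compatible pair comes from an `n`-th power.** Let `φ : Γ_E → Γ_K` be a continuous
homomorphism and `ι : K̄ → Ē` a ring homomorphism over `K → E` compatible with `φ` (`ι (φ τ • x) = τ • ι x`). If the
pull-back of the Kummer class `δ_n(a) ∈ H¹(K, μ_n)` along `φ` is `0`, then `a = cⁿ` for some `c ∈ E`. (Cocycles:
`φ(τ)(α)/α = φ(τ)(η)/η` for some `η ∈ μ_n(K̄)`, so `ι(α/η)` is `Γ_E`-fixed, hence in `E`, and `(α/η)ⁿ = a`.)
The tree's `ShaOneMuRat.exists_eq_pow_of_pullback_kummerMap_eq_zero` is the case `φ = absGaloisRestrict K E`,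
`ι = absClosureEmbedding K E`. [cite: SerreLocalFields1979, X §3] [cite: SerreGaloisCohomology1997, I §2.4 (compatible pairs)] -/
theorem exists_eq_pow_of_pullback_kummerMap_eq_zero_of_compatible
    (φ : absoluteGaloisGroup E →ₜ* absoluteGaloisGroup K)
    (ι : AlgebraicClosure K →+* AlgebraicClosure E)
    (hιK : ∀ x : K, ι (algebraMap K (AlgebraicClosure K) x) =
      algebraMap E (AlgebraicClosure E) (algebraMap K E x))
    (hι : ∀ (τ : absoluteGaloisGroup E) (x : AlgebraicClosure K), ι (φ τ • x) = τ • ι x)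
    (a : Kˣ) (h : galoisCohomology.pullback (mu K n) φ 1 (kummerMap K n a).toAdd = 0) :
    ∃ c : E, algebraMap K E a = c ^ n := by
  -- the Kummer cocycle of a chosen root `α`, `αⁿ = a`
  set α : kummerUnits K n := kummerUnitsRoot K n a with hα_def
  have hx : (kummerMap K n a).toAdd =
      oneCocycleClass (mu K n).toTopRep (kummerOneCocycle K n α) := rfl
  rw [hx] at h
  change (ContinuousCohomology.map φ (X := (mu K n).toTopRep)
    (Y := DiscreteGaloisModule.toTopRep (ContinuousRep.restrict (mu K n) φ))
    (TopRep.ofHom ⟨ContinuousLinearMap.id ℤ (MuCarrier K n), fun _ => rfl⟩) 1).hom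
      (oneCocycleClass (mu K n).toTopRep (kummerOneCocycle K n α)) = 0 at h
  erw [map_oneCocycleClass] at h
  rw [oneCocycleClass_eq_zero_iff] at h
  obtain ⟨v, hv⟩ := h
  -- `φ(τ)(α)/α = φ(τ)(η)/η` for `τ ∈ Γ_E`, `η = muVal v`
  set η : (AlgebraicClosure K)ˣ := muVal K n v with hη_def
  have hquot : ∀ τ : absoluteGaloisGroup E,
      φ τ • (α : (AlgebraicClosure K)ˣ) / (α : (AlgebraicClosure K)ˣ) = φ τ • η / η := by
    intro τ
    have h1 := congrArg (muVal K n) (hv τ)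
    rw [contOneCocycles.pullback_apply] at h1
    exact h1
  have hfix : ∀ τ : absoluteGaloisGroup E,
      φ τ • ((α : (AlgebraicClosure K)ˣ) / η) = (α : (AlgebraicClosure K)ˣ) / η := by
    intro τ
    rw [smul_div', div_eq_div_iff_mul_eq_mul]
    have h2 := hquot τ
    rw [div_eq_div_iff_mul_eq_mul] at h2
    rw [mul_comm (α : (AlgebraicClosure K)ˣ)]
    exact h2
  -- `β = α/η ∈ K̄`, `ι β ∈ Ē` is `Γ_E`-fixed, hence in `E`
  set β : AlgebraicClosure K := (((α : (AlgebraicClosure K)ˣ) / η : (AlgebraicClosure K)ˣ) :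
    AlgebraicClosure K) with hβ_def
  have hβfix : ∀ τ : absoluteGaloisGroup E, τ • ι β = ι β := by
    intro τ
    rw [← hι]
    congr 1
    rw [hβ_def, ← Units.coe_smul, hfix τ]
  obtain ⟨m, c, hc⟩ :=
    absoluteGaloisGroup.exists_algebraMap_eq_pow_of_forall_smul_eq E 1 hβfix
  rw [one_pow, pow_one] at hc
  refine ⟨c, ?_⟩
  -- `βⁿ = a`
  have hβn : β ^ n = algebraMap K (AlgebraicClosure K) a := by
    rw [hβ_def, ← Units.val_pow_eq_pow_val, div_pow, hα_def, kummerUnitsRoot_pow,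
      hη_def, muVal_pow_eq_one, div_one, Units.coe_map, MonoidHom.coe_coe]
  apply (algebraMap E (AlgebraicClosure E)).injective
  rw [map_pow, hc, ← map_pow, hβn, hιK]

/-- **Tower form.** For a tower `K ⊆ L ⊆ E`: if the pull-back of `δ_n(a)` along the COMPOSITE restriction
`Γ_E → Γ_L → Γ_K` (`(absGaloisRestrict K L).comp (absGaloisRestrict L E)`, through the embeddings `K̄ → L̄ → Ē`; this is
the map `galoisCohomology.res_comp` produces, and it differs from `absGaloisRestrict K E` by an inner automorphism)
vanishes, then `a = cⁿ` with `c ∈ E`. [cite: SerreLocalFields1979, X §3] [cite: SerreGaloisCohomology1997, I §2.4 (compatible pairs)] -/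
theorem exists_eq_pow_of_pullback_comp_kummerMap_eq_zero (L : Type) [Field L] [Algebra K L] [Algebra L E]
    [IsScalarTower K L E] (a : Kˣ)
    (h : galoisCohomology.pullback (mu K n) ((absGaloisRestrict K L).comp (absGaloisRestrict L E)) 1
      (kummerMap K n a).toAdd = 0) :
    ∃ c : E, algebraMap K E a = c ^ n := by
  refine exists_eq_pow_of_pullback_kummerMap_eq_zero_of_compatible K E n
    ((absGaloisRestrict K L).comp (absGaloisRestrict L E))
    ((absClosureEmbedding L E).toRingHom.comp (absClosureEmbedding K L).toRingHom)
    (fun x => ?_) (fun τ x => ?_) a h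
  · change absClosureEmbedding L E (absClosureEmbedding K L (algebraMap K (AlgebraicClosure K) x)) = _
    rw [AlgHom.commutes, IsScalarTower.algebraMap_apply K L (AlgebraicClosure L), AlgHom.commutes,
      IsScalarTower.algebraMap_apply L E (AlgebraicClosure E), ← IsScalarTower.algebraMap_apply K L E]
  · change absClosureEmbedding L E (absClosureEmbedding K L
      (absGaloisRestrict K L (absGaloisRestrict L E τ) • x)) = _
    rw [absGaloisRestrict_apply_smul, absGaloisRestrict_apply_smul]
    rfl

end KummerCompatible

/-! ### §2 The local dictionary: an `n`-th power in `F^{nr}` has valuation in `n · v(ϖ)^ℤ` -/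

section Local

open IsNonarchimedeanLocalField

variable {F : Type} [Field F] [ValuativeRel F] [TopologicalSpace F] [IsNonarchimedeanLocalField F]

/-- `‖x ^ k‖ = ‖x‖ ^ k` for `k : ℤ` (from `algNorm_pow`, `algNorm_inv`). [folklore] -/
theorem algNorm_zpow (x : AlgebraicClosure F) (k : ℤ) : algNorm F (x ^ k) = algNorm F x ^ k := by
  cases k with
  | ofNat k => rw [Int.ofNat_eq_natCast, zpow_natCast, zpow_natCast, algNorm_pow]
  | negSucc k => rw [zpow_negSucc, zpow_negSucc, algNorm_inv, algNorm_pow]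

/-- For `x y ∈ F`: `‖x‖ = ‖y‖` in `F̄` iff `v(x) = v(y)` (the spectral norm restricts to the valuation norm,
`algNorm_algebraMap`, which is a strictly monotone function of the valuation, Mathlib `Valued.toNormedField.norm_le_iff`).
[cite: NeukirchANT1999, Ch. II (4.8)] -/
theorem algNorm_algebraMap_eq_iff {x y : F} :
    algNorm F (algebraMap F (AlgebraicClosure F) x) = algNorm F (algebraMap F (AlgebraicClosure F) y) ↔
      valuation F x = valuation F y := by
  letI := IsTopologicalAddGroup.rightUniformSpace F
  haveI := isUniformAddGroup_of_addCommGroup (G := F)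
  letI := rankOneValued F
  rw [algNorm_algebraMap, algNorm_algebraMap, le_antisymm_iff, le_antisymm_iff,
    Valued.toNormedField.norm_le_iff, Valued.toNormedField.norm_le_iff]
  rfl

/-- **An `n`-th power in `F^{nr}` has valuation `v(ϖ)^{n m}`.** Let `ϖ` be a uniformiser of `𝒪[F]`, `x ∈ F^×`, and
`c ∈ F^{nr} = maxUnramified F` with `cⁿ = x` in `F̄`. Then `v(x) = v(ϖ)^{n m}` for some `m ∈ ℤ`: `‖c‖ = ‖ϖ‖^m` because
`F^{nr}/F` is unramified (`exists_algNorm_eq_zpow_of_mem_maxUnramified`, Serre *Local Fields* IV §4 Prop. 16 / Cor. 2),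
so `‖x‖ = ‖ϖ‖^{n m} = ‖ϖ^{n m}‖` and `v(x) = v(ϖ^{n m})`. This is the «only if» half of «`F(x^{1/n})/F` unramified iff
`n ∣ v(x)`» without any hypothesis `μ_n ⊆ F`. [cite: SerreLocalFields1979, Ch. IV §4 Prop. 16 and Cor. 2]
[cite: SilvermanAEC2009, Prop. VIII.1.6 (proof)] -/
theorem exists_valuation_eq_zpow_of_pow_eq_algebraMap_of_mem_maxUnramified {ϖ : 𝒪[F]} (hϖ : Irreducible ϖ)
    {n : ℕ} {x : F} (hx : x ≠ 0) {c : AlgebraicClosure F} (hc : c ∈ maxUnramified F)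
    (h : c ^ n = algebraMap F (AlgebraicClosure F) x) :
    ∃ m : ℤ, valuation F x = valuation F ((ϖ : F) ^ ((n : ℤ) * m)) := by
  rcases Nat.eq_zero_or_pos n with hn | hn
  · subst hn
    refine ⟨0, ?_⟩
    rw [pow_zero] at h
    have hx1 : x = 1 := (algebraMap F (AlgebraicClosure F)).injective (by rw [map_one]; exact h.symm)
    rw [hx1, Nat.cast_zero, zero_mul, zpow_zero]
  have hc0 : c ≠ 0 := by
    rintro rfl
    rw [zero_pow hn.ne'] at h
    exact hx ((map_eq_zero_iff _ (algebraMap F (AlgebraicClosure F)).injective).mp h.symm)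
  obtain ⟨m, hm⟩ := exists_algNorm_eq_zpow_of_mem_maxUnramified hϖ hc hc0
  have hm' : algNorm F c = algNorm F (algebraMap F (AlgebraicClosure F) (ϖ : F)) ^ m := by
    rw [hm, IsScalarTower.algebraMap_apply 𝒪[F] F (AlgebraicClosure F)]
    rfl
  refine ⟨m, ?_⟩
  rw [← algNorm_algebraMap_eq_iff, map_zpow₀, ← h, algNorm_pow, hm', ← zpow_natCast, ← zpow_mul,
    algNorm_zpow, mul_comm m]

/-- **The dictionary in the completion `F_w`** of a number field `F` at a finite place `w` (Mathlib's
`Valued.v : F_w → ℤᵐ⁰`, the tree's local-field structure `AdicCompletionLocalField`): if `x ∈ F_w^×` is an `n`-th power in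
`F_w^{nr}`, then `(n : ℤ) ∣ log v_w(x)`. [cite: SerreLocalFields1979, Ch. IV §4 Prop. 16 and Cor. 2]
[cite: SilvermanAEC2009, Prop. VIII.1.6 (proof)] -/
theorem dvd_log_valued_of_pow_eq_algebraMap_of_mem_maxUnramified (F : Type) [Field F] [NumberField F]
    (w : HeightOneSpectrum (𝓞 F)) {n : ℕ} {x : w.adicCompletion F} (hx : x ≠ 0)
    {c : AlgebraicClosure (w.adicCompletion F)} (hc : c ∈ maxUnramified (w.adicCompletion F))
    (h : c ^ n = algebraMap (w.adicCompletion F) (AlgebraicClosure (w.adicCompletion F)) x) :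
    (n : ℤ) ∣ WithZero.log (Valued.v x) := by
  obtain ⟨ϖ, hϖ⟩ := IsDiscreteValuationRing.exists_irreducible 𝒪[w.adicCompletion F]
  obtain ⟨m, hm⟩ := exists_valuation_eq_zpow_of_pow_eq_algebraMap_of_mem_maxUnramified hϖ hx hc h
  -- transport from the `ValuativeRel` valuation to the compatible `Valued.v`
  have hv : Valued.v x = Valued.v ((ϖ : w.adicCompletion F) ^ ((n : ℤ) * m)) := by
    rw [← Valuation.veq_iff_eq (Valued.v : Valuation (w.adicCompletion F) ℤᵐ⁰),
      Valuation.veq_iff_eq (valuation (w.adicCompletion F))]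
    exact hm
  refine ⟨m * WithZero.log (Valued.v (ϖ : w.adicCompletion F)), ?_⟩
  rw [hv, map_zpow₀, WithZero.log_zpow, smul_eq_mul, mul_assoc]

end Local

/-! ### §3 The global statement: an unramified Kummer class has valuation divisible by `n` -/

section Global

variable (F : Type) [Field F] [NumberField F]

/-- **`H¹_ur` as a kernel along the composite.** For a discrete Galois module `ρ` over a number field `F`, a finite place
`w` and a class `x ∈ Hᵏ(F, M)`: `loc_w x ∈ Hᵏ_ur(F_w, M)` iff the pull-back of `x` along the COMPOSITE restriction
`Γ_{F_w^{nr}} → Γ_{F_w} → Γ_F` vanishes (`unramifiedSubgroup` is the kernel of `res` to `F_w^{nr}`;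
`galoisCohomology.res_comp`). [cite: SerreGaloisCohomology1997, I §2.4] -/
theorem localization_mem_unramifiedSubgroup_iff_pullback_comp_eq_zero
    {M : Type} [AddCommGroup M] [TopologicalSpace M] [DiscreteTopology M] (ρ : DiscreteGaloisModule F M)
    (w : HeightOneSpectrum (𝓞 F)) (k : ℕ) (x : galoisCohomology ρ k) :
    galoisCohomology.localization ρ (Sum.inr w) k x ∈ unramifiedSubgroup (GaloisRep.toLocal w ρ) k ↔
      galoisCohomology.pullback ρ ((absGaloisRestrict F (w.adicCompletion F)).comp
        (absGaloisRestrict (w.adicCompletion F)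
          (IsNonarchimedeanLocalField.maxUnramified (w.adicCompletion F)))) k x = 0 := by
  change galoisCohomology.res (ρ.restrictField (w.adicCompletion F))
      (IsNonarchimedeanLocalField.maxUnramified (w.adicCompletion F)) k
      (galoisCohomology.res ρ (w.adicCompletion F) k x) = 0 ↔ _
  rw [← AddMonoidHom.comp_apply, galoisCohomology.res_comp]
  exact Iff.rfl

variable (n : ℕ) [NeZero (n : F)]

/-- **(K-ur) An unramified Kummer class has valuation divisible by `n`.** For a number field `F`, `n ≥ 1`, `a ∈ F^×`
and any finite place `w` of `F`: if the localisation at `w` of the Kummer class `δ_n(a) ∈ H¹(F, μ_n)` lies in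
`H¹_ur(F_w, μ_n) = ker (H¹(F_w, μ_n) → H¹(F_w^{nr}, μ_n))`, then `(n : ℤ) ∣ log (w.valuation F a)` (`a` is an `n`-th power
in `F_w^{nr}`, and `F_w^{nr}/F_w` is unramified). No hypothesis `w ∤ n` or `μ_n ⊆ F`.
[cite: SilvermanAEC2009, Prop. VIII.1.6 (proof)] [cite: SerreLocalFields1979, Ch. IV §4 Prop. 16 and Cor. 2] -/
theorem dvd_log_valuation_of_localization_kummerMap_mem_unramifiedSubgroup (a : Fˣ)
    (w : HeightOneSpectrum (𝓞 F))
    (h : galoisCohomology.localization (mu F n) (Sum.inr w) 1 (kummerMap F n a).toAdd ∈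
      unramifiedSubgroup (GaloisRep.toLocal w (mu F n)) 1) :
    (n : ℤ) ∣ WithZero.log (w.valuation F (a : F)) := by
  set Fw := w.adicCompletion F with hFw
  set E := IsNonarchimedeanLocalField.maxUnramified Fw with hE
  rw [localization_mem_unramifiedSubgroup_iff_pullback_comp_eq_zero] at h
  haveI : CharZero E := charZero_of_injective_algebraMap (algebraMap F E).injective
  obtain ⟨c, hc⟩ := exists_eq_pow_of_pullback_comp_kummerMap_eq_zero F E n Fw a h
  have h1 : (c : AlgebraicClosure Fw) ^ n = algebraMap Fw (AlgebraicClosure Fw) (algebraMap F Fw (a : F)) := by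
    have h2 : ((c ^ n : E) : AlgebraicClosure Fw) = ((algebraMap F E (a : F) : E) : AlgebraicClosure Fw) :=
      congrArg Subtype.val hc.symm
    rw [SubmonoidClass.coe_pow] at h2
    rw [h2, ← IsScalarTower.algebraMap_apply F Fw (AlgebraicClosure Fw)]
    rfl
  have ha0 : algebraMap F Fw (a : F) ≠ 0 := by
    rw [map_ne_zero]
    exact a.ne_zero
  have hdvd := dvd_log_valued_of_pow_eq_algebraMap_of_mem_maxUnramified F w ha0 c.2 h1
  rwa [show Valued.v (algebraMap F Fw (a : F)) = w.valuation F (a : F) from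
    HeightOneSpectrum.valuedAdicCompletion_eq_valuation' w (a : F)] at hdvd

end Global

end Summit.BirchSwinnertonDyer.BirchSwinnertonDyer.Theorems.PrintCf2.KummerProNull

end
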